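import Summits.QuantumAdvantage.QuantumAdvantage.Theorems.NearExactIsExact.Negative.ReflectedPairSix
import Summits.QuantumAdvantage.QuantumAdvantage.Theorems.NearExactIsExact.Negative.ReflectedFlatPair

/-!
# `NearExactIsExact` (stmt-QuantumAdvantage-14043) — negative lemma: the DUAL PAIR
  (gen 44 disprover; the common generalisation of the reflected flat pair / graph pair / transported
  translation certificates, and the certificate that the two-sided `naff = 4` census actually exhibits)

**Duality (DISPROOF.md §48.10(d), §49).** `c₁ ⊕ c₂∘π = 1_U` with cubic `c₁, c₂` is impossible as soon as a
(multi)set `A` of source points is orthogonal to all cubics, `π(A)` is orthogonal to all cubics, and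
`|A ∩ U|` is odd.  Take `A = S₀ ⊔ S₁` with `S₀ = σ₀(𝔽₂⁵)` an affine 5-flat on which `π` is quadratic and
`S₁ = σ₁(𝔽₂⁵)` ANY parametrised set with `π∘σ₁ = π∘σ₀ ⊕ e` (for a permutation `π` this means
`S₁ = τ_e(S₀)`, `τ_e = π⁻¹∘(· ⊕ e)∘π` the transported translation of `Negative/TransportedTranslation`).
Then `π(A) = X ⊔ (X ⊕ e)` is automatically cubic-even (`Σ_X Δ_e c₂` has degree `≤ 4 < 5` in the
parameter), `S₀` is cubic-even, and the ONLY remaining condition is that `S₁` be cubic-even: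

* `dual_pair` — `Σ_v U(σ₀v) + Σ_v U(σ₁v) = 0` under exactly that hypothesis
  (`∀ c cubic, Σ_v c(σ₁ v) = 0`); `dual_pair_kill` — plus odd total mass ⇒ `False`;
* `comp_deg_affine_one_dir`, `sum_cubic_affine_one_dir` — the hypothesis holds whenever
  `σ₁ = A ⊕ q·F` (`A` affine, `q` quadratic, `F` a constant vector: "affine of quadratic rank one"),
  by the one-direction Taylor expansion `c(a ⊕ λF) = c(a) ⊕ λ·Δ_F c(a)` (degrees `3` and `2+2 < 5`);
  `dual_pair_rank_one` — the resulting parity lemma (it contains `reflected_flat_pair` (`q = 0`) and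
  `reflected_pair_graph` (`F` a unit vector)).

**Why this file (census N4-CENSUS-1 of the two-sided `naff = 4` maps of BQ-11, DISPROOF.md §49).**  For the
transported translation `τ_e` (which is QUADRATIC: `τ_e = id ⊕ (Δ_e π⁻¹)∘π`) and the hyperplane sections
`S₀ = H × {0}` of the zero section, the set of hyperplanes `H = ker α` for which `(S₀, τ_e S₀)` is a dual
pair is an AFFINE subspace of the dual base space (the cubic-evenness of `τ_e(S₀)` is linear in `α`:
`Σ_{u ∈ ker α} f(u) = Σ_l α_l f̂_{[6]∖l} ⊕ f̂_{[6]}(|α|+1)`), computed exactly per map (`ktlin.py`); in the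
gen-44 pilot (25 stratum-(I) maps) EVERY map has such a pair for `e` each of the two twisted base
directions (`t₀ = 0`; 100 cases = 25 maps × 2 sides × 2 directions): in 47 cases `τ_e` restricted to the
zero section is affine of quadratic rank `≤ 1` (then every hyperplane of the right parity works —
`dual_pair_rank_one` verbatim), in the other 53 of rank `2–3` with the linear conditions satisfiable
(`dual_pair` with a finite check; solution spaces of size `1–32`).  The
census numbers are recorded in DISPROOF.md §49; they are data ABOUT these lemmas, not used BY them.

HONEST FRAMING: kernel-checked census-free parity lemmas on the negative side of `NearExactIsExact`
(the last Maiorana–McFarland habitat, BQ-11 `naff = 4`); NOT summit progress — whether EVERY two-sided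
`naff = 4` map carries a dual pair is a finite statement verified map by map, not a theorem here; the
strata `naff ≤ 3`, `naff = 0`, the crux and the summit are untouched.
-/

set_option linter.dupNamespace false -- D-0017: single-problem summit ⇒ `QuantumAdvantage.QuantumAdvantage` by design

namespace Summit.QuantumAdvantage.QuantumAdvantage.Theorems.NearExactIsExact.Negative.DualPair

open Finset
open Literature.Computability.QuantumComplexity
open Literature.Computability.QuantumComplexity.BuzetChailloux (bxor)
open Summit.QuantumAdvantage.QuantumAdvantage.Theorems.CubicForrelation.NearExactIsExact
  (fc_isDegLeFun_comp fc_deg_bxor stub_derivDegree te_isDegLeFun_band)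
open Summit.QuantumAdvantage.QuantumAdvantage.Theorems.NearExactIsExact.Negative.SkewProductCore
open Summit.QuantumAdvantage.QuantumAdvantage.Theorems.NearExactIsExact.Negative.ReflectedPairSix
  (bxor_false_smul bxor_true_smul)
open Summit.QuantumAdvantage.QuantumAdvantage.Theorems.NearExactIsExact.Negative.ReflectedFlatPair
  (sum_ind_eq_zero_of_deg_four)

/-- **DUAL PAIR (parity).** `c₁ ⊕ c₂∘π = U` with `c₁, c₂` cubic; `σ₀ : 𝔽₂⁵ → 𝔽₂ⁿ` affine with `π∘σ₀`
quadratic; `σ₁ : 𝔽₂⁵ → 𝔽₂ⁿ` arbitrary with `π∘σ₁ = π∘σ₀ ⊕ e` and CUBIC-EVEN (`Σ_v c(σ₁ v) = 0` for every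
cubic `c`).  Then `U` has even total mass on `σ₀, σ₁`. [folklore] -/
theorem dual_pair {n : ℕ} (π : (Fin n → Bool) → (Fin n → Bool))
    (c₁ c₂ : (Fin n → Bool) → Bool) (h₁ : IsDegLeFun 3 c₁) (h₂ : IsDegLeFun 3 c₂)
    (U : (Fin n → Bool) → Bool) (hres : ∀ z, (c₁ z ^^ c₂ (π z)) = U z)
    (σ₀ σ₁ : (Fin 5 → Bool) → (Fin n → Bool)) (hσ₀ : ∀ j, IsDegLeFun 1 (fun v => σ₀ v j))
    (hπ : ∀ j, IsDegLeFun 2 (fun v => π (σ₀ v) j)) (e : Fin n → Bool)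
    (hrefl : ∀ v, π (σ₁ v) = bxor (π (σ₀ v)) e)
    (hS₁ : ∀ c : (Fin n → Bool) → Bool, IsDegLeFun 3 c → ∑ v, ind (c (σ₁ v)) = 0) :
    ∑ v, ind (U (σ₀ v)) + ∑ v, ind (U (σ₁ v)) = 0 := by
  have hc0 : IsDegLeFun 3 (fun v : Fin 5 → Bool => c₁ (σ₀ v)) :=
    fc_isDegLeFun_comp h₁ σ₀ hσ₀ (by norm_num)
  have hD : IsDegLeFun 4 (fun v : Fin 5 → Bool => c₂ (π (σ₀ v)) ^^ c₂ (bxor (π (σ₀ v)) e)) :=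
    fc_isDegLeFun_comp (stub_derivDegree n 2 c₂ e h₂) (fun v => π (σ₀ v)) hπ (by norm_num)
  have hpt : ∀ v : Fin 5 → Bool, ind (U (σ₀ v)) + ind (U (σ₁ v)) =
      ind (c₁ (σ₀ v)) + ind (c₁ (σ₁ v)) + ind (c₂ (π (σ₀ v)) ^^ c₂ (bxor (π (σ₀ v)) e)) := by
    intro v
    rw [← hres (σ₀ v), ← hres (σ₁ v), hrefl v, ind_xor, ind_xor, ind_xor]
    ring
  rw [← sum_add_distrib, sum_congr rfl (fun v _ => hpt v), sum_add_distrib, sum_add_distrib,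
    sum_ind_eq_zero_of_deg_four (hc0.mono (by norm_num)), hS₁ c₁ h₁, sum_ind_eq_zero_of_deg_four hD,
    add_zero, add_zero]

/-- **DUAL PAIR (kill).** In the setting of `dual_pair`, odd total `U`-mass is impossible. [folklore] -/
theorem dual_pair_kill {n : ℕ} (π : (Fin n → Bool) → (Fin n → Bool))
    (c₁ c₂ : (Fin n → Bool) → Bool) (h₁ : IsDegLeFun 3 c₁) (h₂ : IsDegLeFun 3 c₂)
    (U : (Fin n → Bool) → Bool) (hres : ∀ z, (c₁ z ^^ c₂ (π z)) = U z)
    (σ₀ σ₁ : (Fin 5 → Bool) → (Fin n → Bool)) (hσ₀ : ∀ j, IsDegLeFun 1 (fun v => σ₀ v j))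
    (hπ : ∀ j, IsDegLeFun 2 (fun v => π (σ₀ v) j)) (e : Fin n → Bool)
    (hrefl : ∀ v, π (σ₁ v) = bxor (π (σ₀ v)) e)
    (hS₁ : ∀ c : (Fin n → Bool) → Bool, IsDegLeFun 3 c → ∑ v, ind (c (σ₁ v)) = 0)
    (hodd : ∑ v, ind (U (σ₀ v)) + ∑ v, ind (U (σ₁ v)) = 1) : False := by
  rw [dual_pair π c₁ c₂ h₁ h₂ U hres σ₀ σ₁ hσ₀ hπ e hrefl hS₁] at hodd
  exact zero_ne_one hodd

/-- One-direction Taylor expansion, pointwise: `c(a ⊕ λF) = c a ⊕ λ·(c a ⊕ c(a ⊕ F))`. [folklore] -/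
theorem taylor_one_dir {n : ℕ} (c : (Fin n → Bool) → Bool) (a F : Fin n → Bool) (l : Bool) :
    c (bxor a (fun j => l && F j)) = (c a ^^ (l && (c a ^^ c (bxor a F)))) := by
  cases l
  · rw [bxor_false_smul]; cases c a <;> rfl
  · rw [bxor_true_smul]; cases c a <;> cases c (bxor a F) <;> rfl

/-- **Cubic ∘ (affine ⊕ one quadratic direction) has degree `≤ 4`.** [folklore] -/
theorem comp_deg_affine_one_dir {m n : ℕ} (c : (Fin n → Bool) → Bool) (hc : IsDegLeFun 3 c)
    (A : (Fin m → Bool) → (Fin n → Bool)) (hA : ∀ j, IsDegLeFun 1 (fun v => A v j))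
    (q : (Fin m → Bool) → Bool) (hq : IsDegLeFun 2 q) (F : Fin n → Bool) :
    IsDegLeFun 4 (fun v => c (bxor (A v) (fun j => q v && F j))) := by
  have h0 : IsDegLeFun 3 (fun v : Fin m → Bool => c (A v)) := fc_isDegLeFun_comp hc A hA (by norm_num)
  have h1 : IsDegLeFun 2 (fun v : Fin m → Bool => c (A v) ^^ c (bxor (A v) F)) :=
    fc_isDegLeFun_comp (stub_derivDegree n 2 c F hc) A hA (by norm_num)
  have e : (fun v => c (bxor (A v) (fun j => q v && F j))) =
      fun v => (c (A v) ^^ (q v && (c (A v) ^^ c (bxor (A v) F)))) :=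
    funext fun v => taylor_one_dir c (A v) F (q v)
  rw [e]
  exact fc_deg_bxor (h0.mono (by norm_num)) ((te_isDegLeFun_band hq h1).mono (by norm_num))

/-- A set parametrised by `𝔽₂⁵` affinely up to one quadratic direction is cubic-even. [folklore] -/
theorem sum_cubic_affine_one_dir {n : ℕ} (A : (Fin 5 → Bool) → (Fin n → Bool))
    (hA : ∀ j, IsDegLeFun 1 (fun v => A v j)) (q : (Fin 5 → Bool) → Bool) (hq : IsDegLeFun 2 q)
    (F : Fin n → Bool) (σ₁ : (Fin 5 → Bool) → (Fin n → Bool))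
    (hσ₁ : ∀ v, σ₁ v = bxor (A v) (fun j => q v && F j)) :
    ∀ c : (Fin n → Bool) → Bool, IsDegLeFun 3 c → ∑ v, ind (c (σ₁ v)) = 0 := by
  intro c hc
  have e : (fun v : Fin 5 → Bool => c (σ₁ v)) = fun v => c (bxor (A v) (fun j => q v && F j)) :=
    funext fun v => by rw [hσ₁ v]
  have h4 : IsDegLeFun 4 (fun v : Fin 5 → Bool => c (σ₁ v)) := by
    rw [e]; exact comp_deg_affine_one_dir c hc A hA q hq F
  exact sum_ind_eq_zero_of_deg_four h4

/-- **DUAL PAIR OF QUADRATIC RANK ONE.** `c₁ ⊕ c₂∘π = U`, `σ₀` affine with `π∘σ₀` quadratic,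
`σ₁ = A ⊕ q·F` (`A` affine, `q` quadratic, `F` constant) with `π∘σ₁ = π∘σ₀ ⊕ e` ⇒ even total mass.
(`q = 0`: the reflected flat pair; `F` a unit vector: the reflected graph pair.) [folklore] -/
theorem dual_pair_rank_one {n : ℕ} (π : (Fin n → Bool) → (Fin n → Bool))
    (c₁ c₂ : (Fin n → Bool) → Bool) (h₁ : IsDegLeFun 3 c₁) (h₂ : IsDegLeFun 3 c₂)
    (U : (Fin n → Bool) → Bool) (hres : ∀ z, (c₁ z ^^ c₂ (π z)) = U z)
    (σ₀ : (Fin 5 → Bool) → (Fin n → Bool)) (hσ₀ : ∀ j, IsDegLeFun 1 (fun v => σ₀ v j))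
    (A : (Fin 5 → Bool) → (Fin n → Bool)) (hA : ∀ j, IsDegLeFun 1 (fun v => A v j))
    (q : (Fin 5 → Bool) → Bool) (hq : IsDegLeFun 2 q) (F : Fin n → Bool)
    (σ₁ : (Fin 5 → Bool) → (Fin n → Bool)) (hσ₁ : ∀ v, σ₁ v = bxor (A v) (fun j => q v && F j))
    (hπ : ∀ j, IsDegLeFun 2 (fun v => π (σ₀ v) j)) (e : Fin n → Bool)
    (hrefl : ∀ v, π (σ₁ v) = bxor (π (σ₀ v)) e) :
    ∑ v, ind (U (σ₀ v)) + ∑ v, ind (U (σ₁ v)) = 0 :=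
  dual_pair π c₁ c₂ h₁ h₂ U hres σ₀ σ₁ hσ₀ hπ e hrefl (sum_cubic_affine_one_dir A hA q hq F σ₁ hσ₁)

/-- **TRANSPORTED DUAL PAIR.** For a permutation (`π (σ z) = z`) the second set is forced:
`σ₁ = τ_e ∘ σ₀`, `τ_e = σ∘(· ⊕ e)∘π`; if `τ_e(S₀)` is cubic-even the pair has even mass. [folklore] -/
theorem dual_pair_transported {n : ℕ} (π σ : (Fin n → Bool) → (Fin n → Bool))
    (hπσ : ∀ z, π (σ z) = z)
    (c₁ c₂ : (Fin n → Bool) → Bool) (h₁ : IsDegLeFun 3 c₁) (h₂ : IsDegLeFun 3 c₂)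
    (U : (Fin n → Bool) → Bool) (hres : ∀ z, (c₁ z ^^ c₂ (π z)) = U z)
    (hπ2 : ∀ j, IsDegLeFun 2 (fun w => π w j)) (e : Fin n → Bool)
    (σ₀ : (Fin 5 → Bool) → (Fin n → Bool)) (hσ₀ : ∀ j, IsDegLeFun 1 (fun v => σ₀ v j))
    (hS₁ : ∀ c : (Fin n → Bool) → Bool, IsDegLeFun 3 c →
      ∑ v, ind (c (σ (bxor (π (σ₀ v)) e))) = 0) :
    ∑ v, ind (U (σ₀ v)) + ∑ v, ind (U (σ (bxor (π (σ₀ v)) e))) = 0 :=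
  dual_pair π c₁ c₂ h₁ h₂ U hres σ₀ (fun v => σ (bxor (π (σ₀ v)) e)) hσ₀
    (fun j => fc_isDegLeFun_comp (hπ2 j) σ₀ hσ₀ (by norm_num)) e (fun v => hπσ _) hS₁

end Summit.QuantumAdvantage.QuantumAdvantage.Theorems.NearExactIsExact.Negative.DualPair
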